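import Literature.AlgebraicGeometry.Morphisms.DevissageHeart
import Literature.AlgebraicGeometry.Morphisms.DevissageExactClass
import HarnessLib

/-!
# The integral heart of the dévissage for an arbitrary exact class, from the structure sheaves of
# the integral closed subschemes (Görtz–Wedhorn I, Lemma 12.63 (iii)); the finiteness theorem for
# proper schemes over a field modulo `Hⁿ(X, ι_*𝒪_Z)`

`Morphisms/DevissageHeart.heart_induction` proves step (iii) of Görtz–Wedhorn I, Lemma 12.63 ("Thus
we may assume that `X` is integral … by induction hypothesis `Ker(u)` and `Coker(u)` are in `𝒦`. Hence
`𝓕` is in `𝒦` by (i)") for the ONE class of `Morphisms/DevissageClass` (finite Čech `H⁰`, `H¹`), by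
induction on the generic number of generators, peeling off rank-one pieces `𝒥₂𝒪_Z ↪ M/M[𝓘ᵏ]`; its
only class-specific input is `𝒪_Z ∈ 𝒦` for the integral closed subscheme `Z = V(𝒥)`
(`Morphisms/DevissageHeartOZ`, through Chow's lemma). This file re-runs that induction — verbatim — for
an ARBITRARY class `K` of modules on a quasi-compact locally Noetherian scheme which is closed under
kernels of epimorphisms between coherent members (`hK₁`: `M, M'' ∈ K ⇒ M' ∈ K`) and under extensions
(`hK₂`: `M', M'' ∈ K ⇒ M ∈ K`), taking `ι_*𝒪_Z ∈ K` as the HYPOTHESIS `hOZ`: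

* `mem_of_generic_torsion` — the generic-rank-zero case (as `DevissageRankZero.inK_of_generic_torsion`);
* `mem_idealOZ` — `𝒥₂𝒪_Z ∈ K` for `𝒥₂ > 𝒥` (as `DevissageIdealPowers.inK_idealOZ`), from `hOZ`, `hK₁`
  and the induction hypothesis of the dévissage;
* `heart_induction_of_exactClass`, `heart_of_exactClass` — step (iii) for `K`;
* `GortzWedhorn2023_cohomology_proper_coherent_finite_of_structureSheaf` — with the class
  `𝒦_Ext = {M | ∀ n, Extⁿ_{𝒪_X}(𝒪_X, M) finite}` (`Morphisms/ExtUnitFiniteClass`, exact) and the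
  dévissage `Morphisms/DevissageExactClass`: **the named fact
  `GortzWedhorn2023_cohomology_proper_coherent_finite` (Görtz–Wedhorn II Cor. 23.18 over a field: all
  coherent `𝓕`, all proper `X`, all degrees, on its derived carrier) follows from the single input
  «for every field `k`, every proper `X → Spec k` and every integral closed subscheme
  `ι : Z = V(𝒥) ↪ X` (`𝒥 ≠ ⊤` radical with irreducible support), `Extⁿ_{𝒪_X}(𝒪_X, ι_*𝒪_Z)` is a
  finite-dimensional `k`-vector space for every `n`»** — Görtz–Wedhorn II, Thm. 23.17 (3) for
  `𝓖 = 𝒪_Z` (there: Chow's lemma and the projective case; in this tree: the finiteness of the Čech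
  cohomology of the rank-one family `𝒪_Z`, `Motives/CechCoherentDevissage`, once compared with `Ext`).

Everything here is proved; no named facts are introduced; the input is an explicit hypothesis.

## References

* U. Görtz, T. Wedhorn, *Algebraic Geometry I: Schemes*, 2nd ed. (2020): Lemma 12.63 (iii), p. 437.
  [GortzWedhorn2020]
* U. Görtz, T. Wedhorn, *Algebraic Geometry II* (2023): Thm. 23.17 (proof, (1)–(3)), Cor. 23.18,
  pp. 424–425. [GortzWedhorn2023]
* A. Grothendieck, EGA III (Publ. Math. IHÉS 11, 1961), 3.1.2, 3.1.3, 3.2.1. [folklore]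
-/

noncomputable section

open CategoryTheory CategoryTheory.Limits AlgebraicGeometry TopologicalSpace Opposite
open Literature.AlgebraicGeometry.Modules

universe u

namespace Literature.AlgebraicGeometry.Morphisms

variable {X : Scheme.{u}} [IsLocallyNoetherian X] [CompactSpace X] {K : X.Modules → Prop}

/-- **The rank-zero case of the integral step, for an arbitrary class `K`.** Let `𝒥` be a proper
radical ideal sheaf, `M` coherent with `𝒥M = 0`, and suppose that on some affine open `W` a function `b`
that does not vanish on the whole of `V(𝒥) ∩ W` acts nilpotently on all sections of `M` over `W`. If the
dévissage claim holds for all ideal sheaves `> 𝒥`, then `M ∈ K` (it is killed by `𝒥 + 𝓘ⁿ > 𝒥`).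
[cite: GortzWedhorn2020, Lemma 12.63 (iii) (p. 437)] -/
theorem mem_of_generic_torsion {J : X.IdealSheafData} (hJtop : J ≠ ⊤) (hJrad : J.radical = J)
    (ih : ∀ J' > J, ∀ M : X.Modules, Coh M → IsKilledBy J' M → K M)
    {M : X.Modules} (hM : Coh M) (hJM : IsKilledBy J M) {W : X.Opens} (hW : IsAffineOpen W)
    (b : Γ(X, W)) (hbZ : ∃ x ∈ X.basicOpen b, x ∈ (J.support : Set X))
    (hb : ∀ m : Γ(M, W), ∃ k : ℕ, b ^ k • m = 0) : K M := by
  classical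
  let T : Closeds X := ⟨((X.basicOpen b : X.Opens) : Set X)ᶜ, (X.basicOpen b).isOpen.isClosed_compl⟩
  obtain ⟨t, ht⟩ := exists_finite_affineOpens_iSup_eq_top (X := X)
  obtain ⟨n, hn⟩ := exists_isKilledBy_sup_pow J hM.loc hM.ft (fun V : t => (V : X.affineOpens)) ht
    (I := Scheme.IdealSheafData.vanishingIdeal T) hJM fun k g hg m =>
      sections_eq_zero_of_pow_smul_eq_zero hM.loc hW b hb
        (basicOpen_le_of_mem_vanishingIdeal_compl b (k : X.affineOpens).2 hg) _
  have hT : ¬ ((J.support : Set X) ⊆ (T : Set X)) := fun h => by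
    obtain ⟨x, hxb, hxJ⟩ := hbZ
    exact h hxJ hxb
  exact ih _ (lt_sup_vanishingIdeal_pow hJtop hJrad hT n) M hM hn

variable
  (hK₁ : ∀ ⦃S : ShortComplex X.Modules⦄, S.ShortExact → Coh S.X₂ → Coh S.X₃ → K S.X₂ → K S.X₃ → K S.X₁)

omit [CompactSpace X] in
include hK₁ in
/-- **`𝒥₂𝒪_Z ∈ K` for `𝒥₂ > 𝒥`**, granted `ι_*𝒪_Z ∈ K` and the dévissage claim above `𝒥`
(`0 → 𝒥₂𝒪_Z → ι_*𝒪_Z → Q → 0` with `Q` coherent and killed by `𝒥₂`).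
[cite: GortzWedhorn2020, Lemma 12.63 (iii) (p. 437)] -/
theorem mem_idealOZ {J J₂ : X.IdealSheafData}
    (ih : ∀ J' > J, ∀ M : X.Modules, Coh M → IsKilledBy J' M → K M)
    (hOZ : K ((Scheme.Modules.pushforward J.subschemeι).obj (SheafOfModules.unit J.subscheme.ringCatSheaf)))
    (hlt : J < J₂) : K (idealOZ J hlt.le) := by
  have hQcoh : Coh (cokernel (kernel.ι (idealOZHom J hlt.le))) :=
    ⟨IsAffineLocalizing.of_shortExact₃ shortExact_idealOZ coh_idealOZ.loc (coh_pushforward_unit_subscheme J).loc,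
      IsAffineFiniteType.of_shortExact₃ shortExact_idealOZ coh_idealOZ.loc (coh_pushforward_unit_subscheme J).ft⟩
  have hQ := ih J₂ hlt _ hQcoh isKilledBy_cokernel_idealOZ
  exact hK₁ shortExact_idealOZ (coh_pushforward_unit_subscheme J) hQcoh hOZ hQ

section Heart

variable
  (hK₂ : ∀ ⦃S : ShortComplex X.Modules⦄, S.ShortExact → Coh S.X₁ → Coh S.X₃ → K S.X₁ → K S.X₃ → K S.X₂)
  {J : X.IdealSheafData} (hJtop : J ≠ ⊤) (hJrad : J.radical = J)
  (hJirr : IsPreirreducible ((J.support : Closeds X) : Set X))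
  (ih : ∀ J' > J, ∀ M : X.Modules, Coh M → IsKilledBy J' M → K M)
  (hOZ : K ((Scheme.Modules.pushforward J.subschemeι).obj (SheafOfModules.unit J.subscheme.ringCatSheaf)))
  {W : X.Opens} (hW : IsAffineOpen W) (hWZ : Nonempty (J.subschemeι ⁻¹ᵁ W))

include hK₁ hK₂ hJtop hJrad hJirr ih hOZ hWZ

/-- **Step (iii) of the dévissage, by induction on the generic number of generators**: a coherent
`M` with `𝒥M = 0` whose sections over the affine `W` (meeting `Z`) are spanned, up to multiplication
by functions not in the prime `𝒥(W)`, by at most `e` sections, lies in `K`. (The proof is that of `DevissageHeart.heart_induction`, for the class `K`.)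
[cite: GortzWedhorn2020, Lemma 12.63 (iii) (p. 437)] -/
theorem heart_induction_of_exactClass (e : ℕ) : ∀ (M : X.Modules), Coh M → IsKilledBy J M →
    (∃ xs : Finset Γ(M, W), xs.card ≤ e ∧ ∀ m : Γ(M, W), ∃ c : Γ(X, W), c ∉ J.ideal ⟨W, hW⟩ ∧
      c • m ∈ Submodule.span Γ(X, W) (xs : Set Γ(M, W))) → K M := by
  classical
  have hZne : ((J.support : Closeds X) : Set X).Nonempty := by
    obtain ⟨⟨z, _⟩⟩ := hWZ
    refine ⟨J.subschemeι.base z, ?_⟩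
    rw [← Scheme.IdealSheafData.range_subschemeι]; exact ⟨z, rfl⟩
  haveI : IsIntegral J.subscheme := isIntegral_subscheme J hJrad ⟨hZne, hJirr⟩
  have hprime : (J.ideal ⟨W, hW⟩).IsPrime := isPrime_ideal J hW hWZ
  haveI : IsNoetherianRing Γ(X, W) := IsLocallyNoetherian.component_noetherian ⟨W, hW⟩
  have hsuppI : ¬ ((J.support : Set X) ⊆ ((complBasicOpen (1 : Γ(X, W)) : Closeds X) : Set X)) := by
    intro h
    obtain ⟨⟨z, hz⟩⟩ := hWZ
    have hzJ : J.subschemeι.base z ∈ (J.support : Set X) := by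
      rw [← Scheme.IdealSheafData.range_subschemeι]; exact ⟨z, rfl⟩
    have := h hzJ
    change J.subschemeι.base z ∉ ((X.basicOpen (1 : Γ(X, W)) : X.Opens) : Set X) at this
    rw [Scheme.basicOpen_one] at this
    exact this hz
  induction e with
  | zero =>
    rintro M hM hJM ⟨xs, hxs, hgen⟩
    have hxs0 : xs = ∅ := Finset.card_eq_zero.mp (Nat.le_zero.mp hxs)
    subst hxs0
    haveI := hM.ft hW
    obtain ⟨G, hG⟩ := Module.Finite.fg_top (R := Γ(X, W)) (M := Γ(M, W))
    have hc : ∀ m ∈ G, ∃ c : Γ(X, W), c ∉ J.ideal ⟨W, hW⟩ ∧ c • m = 0 := fun m _ => by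
      obtain ⟨c, hc, hcm⟩ := hgen m
      rw [Finset.coe_empty, Submodule.span_empty, Submodule.mem_bot] at hcm
      exact ⟨c, hc, hcm⟩
    choose! c hc hcm using hc
    have hb : (∏ m ∈ G, c m) ∉ J.ideal ⟨W, hW⟩ :=
      Finset.prod_induction _ (fun x => x ∉ J.ideal ⟨W, hW⟩)
        (fun x y hx hy hxy => (hprime.mem_or_mem hxy).elim hx hy)
        (fun h1 => hprime.ne_top ((Ideal.eq_top_iff_one _).mpr h1)) hc
    have hbm : ∀ m : Γ(M, W), (∏ m ∈ G, c m) • m = 0 := by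
      intro m
      have hm : m ∈ Submodule.span Γ(X, W) (G : Set Γ(M, W)) := by rw [hG]; trivial
      refine Submodule.span_induction (p := fun m _ => (∏ m ∈ G, c m) • m = 0) ?_ ?_ ?_ ?_ hm
      · intro g hg
        rw [← Finset.prod_erase_mul _ _ hg, mul_smul, hcm g hg, smul_zero]
      · rw [smul_zero]
      · intro a b _ _ ha hb; rw [smul_add, ha, hb, add_zero]
      · intro r m _ h; rw [smul_comm, h, smul_zero]
    exact mem_of_generic_torsion hJtop hJrad ih hM hJM hW _ (exists_mem_basicOpen_support hJrad hW hb)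
      fun m => ⟨1, by rw [pow_one]; exact hbm m⟩
  | succ e ihe =>
    rintro M hM hJM ⟨xs, hxs, hgen⟩
    by_cases hxe : xs.card ≤ e
    · exact ihe M hM hJM ⟨xs, hxe, hgen⟩
    have hne : xs.Nonempty := Finset.card_pos.mp (by omega)
    obtain ⟨x₁, hx₁⟩ := hne
    set xs' := xs.erase x₁ with hxs'def
    have hcard' : xs'.card ≤ e := by rw [Finset.card_erase_of_mem hx₁]; omega
    have hins : insert x₁ xs' = xs := Finset.insert_erase hx₁
    have hgen' : ∀ m : Γ(M, W), ∃ c : Γ(X, W), c ∉ J.ideal ⟨W, hW⟩ ∧ ∃ a : Γ(X, W),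
        ∃ y ∈ Submodule.span Γ(X, W) (xs' : Set Γ(M, W)), c • m = a • x₁ + y := by
      intro m
      obtain ⟨c, hc, hcm⟩ := hgen m
      rw [← hins, Finset.coe_insert, Submodule.mem_span_insert] at hcm
      obtain ⟨a, y, hy, hcm⟩ := hcm
      exact ⟨c, hc, a, y, hy, hcm⟩
    by_cases htor : ∃ d : Γ(X, W), d ∉ J.ideal ⟨W, hW⟩ ∧ d • x₁ = 0
    · -- Case A: `x₁` is torsion and may be dropped
      obtain ⟨d, hd, hdx⟩ := htor
      refine ihe M hM hJM ⟨xs', hcard', fun m => ?_⟩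
      obtain ⟨c, hc, a, y, hy, hcm⟩ := hgen' m
      refine ⟨d * c, fun h => (hprime.mem_or_mem h).elim hd hc, ?_⟩
      rw [mul_smul, hcm, smul_add, smul_comm, hdx, smul_zero, zero_add]
      exact Submodule.smul_mem _ _ hy
    -- Case B: `ann(x₁) ⊆ 𝒥(W)`
    push Not at htor
    have hx₁tf : ∀ d : Γ(X, W), d • x₁ = 0 → d ∈ J.ideal ⟨W, hW⟩ := fun d hd =>
      by_contra fun h => htor d h hd
    -- the ideal `𝓘` of `X ∖ W`, the stable torsion index, `M' = M[𝓘ᵏ]`, `M₁ = M/M'`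
    obtain ⟨k, hk⟩ := exists_torsion_pow_stable (J := complIdeal (1 : Γ(X, W))) hM.loc hM.ft
    have hS := shortExact_torsion M (complIdeal (1 : Γ(X, W)) ^ k)
    have hM'coh : Coh (torsion M (complIdeal (1 : Γ(X, W)) ^ k)) := hM.torsion _
    have hM' : K (torsion M (complIdeal (1 : Γ(X, W)) ^ k)) := by
      refine ih _ (lt_sup_vanishingIdeal_pow hJtop hJrad hsuppI k) _ hM'coh ?_
      exact IsKilledBy.sup (IsKilledBy.of_app_injective (torsionι M _)
        (fun V => torsionι_app_injective M _ V) hJM) (isKilledBy_torsion M _)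
    have hM₁coh : Coh (cokernel (torsionι M (complIdeal (1 : Γ(X, W)) ^ k))) := hM.cokernel_torsionι _
    have hJM₁ : IsKilledBy J (cokernel (torsionι M (complIdeal (1 : Γ(X, W)) ^ k))) :=
      IsKilledBy.of_shortExact₃ hS hM'coh.loc hJM
    -- notation
    set M₁ := cokernel (torsionι M (complIdeal (1 : Γ(X, W)) ^ k)) with hM₁def
    set π₁ := cokernel.π (torsionι M (complIdeal (1 : Γ(X, W)) ^ k)) with hπ₁def
    have htf₁ : ∀ ⦃V : X.Opens⦄ (hV : IsAffineOpen V) (m : Γ(M₁, V)),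
        (∀ a ∈ (complIdeal (1 : Γ(X, W))).ideal ⟨V, hV⟩, a • m = 0) → m = 0 :=
      fun V hV m hm => torsionFree_cokernel_torsionι hM.loc hk hV m hm
    set x₁' : Γ(M₁, W) := π₁.app W x₁ with hx₁'def
    set s : Γ(M₁, X.basicOpen (1 : Γ(X, W))) := M₁.presheaf.map (homOfLE (X.basicOpen_le _)).op x₁' with hsdef
    -- the extension setup, on the covering `t₀ ∪ {W}`
    obtain ⟨t₀, ht₀⟩ := exists_finite_affineOpens_iSup_eq_top (X := X)
    have ht : ⨆ V : (insert (⟨W, hW⟩ : X.affineOpens) t₀ : Finset X.affineOpens),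
        ((V : X.affineOpens) : X.Opens) = ⊤ := by
      refine top_le_iff.mp (ht₀.symm.le.trans (iSup_le fun V => ?_))
      exact le_iSup (fun V : (insert (⟨W, hW⟩ : X.affineOpens) t₀ : Finset X.affineOpens) =>
        ((V : X.affineOpens) : X.Opens)) ⟨V.1, Finset.mem_insert_of_mem V.2⟩
    have hexp : ∀ V : (insert (⟨W, hW⟩ : X.affineOpens) t₀ : Finset X.affineOpens), ∃ n : ℕ,
        ∀ a ∈ (complIdeal (1 : Γ(X, W))).ideal (V : X.affineOpens) ^ n,
          ∃ x, IsExtension M₁ (complIdeal (1 : Γ(X, W))) s (V : X.affineOpens).2 a x :=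
      fun V => exists_isExtension_of_affine hM₁coh.loc (V : X.affineOpens).2 (IdealSheafData.fg_ideal _ _)
        (fun g hg => basicOpen_le_of_mem_complIdeal _ (V : X.affineOpens).2 hg)
    choose nV hnV using hexp
    let D : ExtSetup X :=
      { J := J, M := M₁, hM := hM₁coh.loc, hJM := hJM₁, W := W, b₀ := 1, s := s, htf := htf₁,
        t := insert (⟨W, hW⟩ : X.affineOpens) t₀, ht := ht, n := Finset.univ.sup nV,
        hn := fun V a ha => hnV V a (Ideal.pow_le_pow_right (Finset.le_sup (Finset.mem_univ V)) ha) }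
    -- `φ : 𝒥₂𝒪_Z → M₁` is a monomorphism
    have hbZ : Nonempty (J.subschemeι ⁻¹ᵁ X.basicOpen (1 : Γ(X, W))) := by rwa [Scheme.basicOpen_one]
    have hTF : ∀ ⦃V' : X.Opens⦄ (_ : IsAffineOpen V') (hle : V' ≤ X.basicOpen (1 : Γ(X, W))) (c : Γ(X, V')),
        c • M₁.presheaf.map (homOfLE hle).op s = 0 → J.subschemeι.app V' c = 0 := by
      intro V' hV' hle c hc
      have hle' : V' ≤ W := hle.trans (X.basicOpen_le _)
      refine app_eq_zero_of_smul_eq_zero J hM.loc hW hprime x₁ hx₁tf hle' c ?_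
      -- `π₁ (c • x₁|) = c • s| = 0`
      have h1 : π₁.app V' (c • M.presheaf.map (homOfLE hle').op x₁) = 0 := by
        rw [Scheme.Modules.Hom.app_smul, ← map_app, ← hc, hsdef, map_map]
        exact congrArg (c • ·) (map_eq_map M₁ _ _ _)
      obtain ⟨y, hy⟩ := (sections_exact_of_shortExact hS V').2 _ h1
      change (torsionι M _).app V' y = c • M.presheaf.map (homOfLE hle').op x₁ at hy
      rw [← hy]
      -- `y` is killed by `𝓘(V')ᵏ = ⊤`
      have hy0 : y = 0 := by
        have h1mem : (1 : Γ(X, V')) ∈ (complIdeal (1 : Γ(X, W)) ^ k).ideal ⟨V', hV'⟩ := by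
          rw [Scheme.IdealSheafData.ideal_pow, Pi.pow_apply, complIdeal_ideal_eq_top _ hV' hle, Ideal.top_pow]
          trivial
        have := isKilledBy_torsion M (complIdeal (1 : Γ(X, W)) ^ k) ⟨V', hV'⟩ 1 h1mem y
        rwa [one_smul] at this
      rw [hy0, map_zero]
    haveI : Mono D.extHom := D.mono_extHom hbZ hTF
    have hS₂ : (ShortComplex.mk D.extHom (cokernel.π D.extHom) (cokernel.condition _)).ShortExact :=
      ShortComplex.ShortExact.mk' (ShortComplex.exact_cokernel _) inferInstance inferInstance
    -- `𝒥₂𝒪_Z ∈ 𝒦`, `M₂ := coker φ` coherent and killed by `𝒥`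
    have hlt₂ : J < D.J₂ := lt_sup_vanishingIdeal_pow hJtop hJrad hsuppI D.n
    have hH : K D.H := mem_idealOZ hK₁ ih hOZ hlt₂
    have hHcoh : Coh D.H := coh_idealOZ
    set π₂ := cokernel.π D.extHom with hπ₂def
    have hM₂coh : Coh (cokernel D.extHom) :=
      ⟨IsAffineLocalizing.of_shortExact₃ hS₂ hHcoh.loc hM₁coh.loc,
        IsAffineFiniteType.of_shortExact₃ hS₂ hHcoh.loc hM₁coh.ft⟩
    have hJM₂ : IsKilledBy J (cokernel D.extHom) := IsKilledBy.of_shortExact₃ hS₂ hHcoh.loc hJM₁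
    -- every `a • x̄₁` dies in `M₂`
    have hkill : ∀ a : Γ(X, W), π₂.app W (a • x₁') = 0 := by
      intro a
      let p₀ : D.ιB := ⟨⟨⟨W, hW⟩, Finset.mem_insert_self _ _⟩, (1 : Γ(X, W))⟩
      have hle₀ : D.B p₀ ≤ W := X.basicOpen_le (1 : Γ(X, W))
      have hge₀ : W ≤ D.B p₀ := by
        change W ≤ X.basicOpen (1 : Γ(X, W)); rw [Scheme.basicOpen_one]
      -- `a| ∈ 𝒥₂(D(1)) = ⊤`
      have ha' : X.presheaf.map (homOfLE hle₀).op a ∈ D.J₂.ideal ⟨D.B p₀, D.isAffineOpen_B p₀⟩ := by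
        have htop : (complIdeal (1 : Γ(X, W))).ideal ⟨D.B p₀, D.isAffineOpen_B p₀⟩ = ⊤ :=
          complIdeal_ideal_eq_top _ _ le_rfl
        rw [Scheme.IdealSheafData.ideal_sup, Scheme.IdealSheafData.ideal_pow]
        refine Submodule.mem_sup_right ?_
        rw [Pi.pow_apply, htop, Ideal.top_pow]
        trivial
      have hker : (idealOZHom D.J D.le_J₂).app (D.B p₀)
          (J.subschemeι.app _ (X.presheaf.map (homOfLE hle₀).op a)) = 0 := by
        rw [pushforwardUnitHom_app_apply]
        have := subschemeι_app_eq_zero D.J₂ (V := ⟨D.B p₀, D.isAffineOpen_B p₀⟩) ha'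
        rw [← Scheme.IdealSheafData.inclusion_subschemeι D.le_J₂, Scheme.Hom.comp_app] at this
        exact this
      obtain ⟨kk, hkk⟩ := exists_kernel_ι_app_eq (idealOZHom D.J D.le_J₂) (D.B p₀) _ hker
      have hφ : D.extHom.app (D.B p₀) kk =
          X.presheaf.map (homOfLE hle₀).op a • M₁.presheaf.map (homOfLE hle₀).op x₁' :=
        D.extHom_app_eq_smul p₀ kk hkk.symm _ fun g hg hgW => by
          change M₁.presheaf.map _ (M₁.presheaf.map _ x₁') =
            M₁.presheaf.map _ (M₁.presheaf.map (homOfLE (X.basicOpen_le (1 : Γ(X, W)))).op x₁')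
          rw [map_map, map_map]
          exact map_eq_map M₁ _ _ _
      have h1 : π₂.app (D.B p₀)
          (X.presheaf.map (homOfLE hle₀).op a • M₁.presheaf.map (homOfLE hle₀).op x₁') = 0 := by
        rw [← hφ]
        exact app_app_eq_zero (ShortComplex.mk D.extHom π₂ (cokernel.condition _)) _ kk
      have h2 : (cokernel D.extHom).presheaf.map (homOfLE hle₀).op (π₂.app W (a • x₁')) = 0 := by
        rw [map_app, Scheme.Modules.map_smul]; exact h1
      have h3 := congrArg ((cokernel D.extHom).presheaf.map (homOfLE hge₀).op) h2
      rwa [map_map, map_self, map_zero] at h3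
    -- `M₂` is generically spanned by the images of `xs'`, so lies in `𝒦` by induction
    have hM₂ : K (cokernel D.extHom) := by
      refine ihe _ hM₂coh hJM₂ ⟨xs'.image (fun x => π₂.app W (π₁.app W x)),
        Finset.card_image_le.trans hcard', fun m₂ => ?_⟩
      obtain ⟨m₁, rfl⟩ := app_surjective_of_shortExact hS₂ hHcoh.loc hW m₂
      obtain ⟨m, rfl⟩ := app_surjective_of_shortExact hS hM'coh.loc hW m₁
      obtain ⟨c, hc, a, y, hy, hcm⟩ := hgen' m
      refine ⟨c, hc, ?_⟩
      change c • π₂.app W (π₁.app W m) ∈ _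
      rw [← Scheme.Modules.Hom.app_smul, ← Scheme.Modules.Hom.app_smul, hcm, map_add, map_add,
        Scheme.Modules.Hom.app_smul, hkill a, zero_add, Finset.coe_image]
      have : (appLinear π₂ W).comp (appLinear π₁ W) y ∈ Submodule.span Γ(X, W)
          (((appLinear π₂ W).comp (appLinear π₁ W)) '' (xs' : Set Γ(M, W))) := by
        rw [← Submodule.map_span]; exact Submodule.mem_map_of_mem hy
      exact this
    -- conclude
    have hM₁ : K M₁ := hK₂ hS₂ hHcoh hM₂coh hH hM₂
    exact hK₂ hS hM'coh hM₁coh hM' hM₁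

end Heart

/-- **The integral step of the dévissage for an arbitrary class** (Görtz–Wedhorn I, Lemma 12.63 (iii)):
for `K` closed under kernels of epimorphisms and under extensions (of coherent modules), a proper radical
ideal sheaf `𝒥` with irreducible support, the dévissage claim granted above `𝒥`, and `ι_*𝒪_{V(𝒥)} ∈ K`,
every coherent `M` with `𝒥M = 0` lies in `K`. [cite: GortzWedhorn2020, Lemma 12.63 (iii) (p. 437)] -/
theorem heart_of_exactClass
    (hK₁ : ∀ ⦃S : ShortComplex X.Modules⦄, S.ShortExact → Coh S.X₂ → Coh S.X₃ → K S.X₂ → K S.X₃ → K S.X₁)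
    (hK₂ : ∀ ⦃S : ShortComplex X.Modules⦄, S.ShortExact → Coh S.X₁ → Coh S.X₃ → K S.X₁ → K S.X₃ → K S.X₂)
    (J : X.IdealSheafData) (hJtop : J ≠ ⊤) (hJrad : J.radical = J)
    (hJirr : IsPreirreducible ((J.support : Closeds X) : Set X))
    (ih : ∀ J' > J, ∀ M : X.Modules, Coh M → IsKilledBy J' M → K M)
    (hOZ : K ((Scheme.Modules.pushforward J.subschemeι).obj (SheafOfModules.unit J.subscheme.ringCatSheaf)))
    (M : X.Modules) (hM : Coh M) (hJM : IsKilledBy J M) : K M := by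
  classical
  -- an affine open `W` meeting `Z`
  have hne : ((J.support : Closeds X) : Set X).Nonempty := by
    rw [Set.nonempty_iff_ne_empty]
    intro h0
    exact hJtop ((Scheme.IdealSheafData.support_eq_bot_iff J).mp (Closeds.ext h0))
  obtain ⟨x, hx⟩ := hne
  obtain ⟨W, hW, hxW, -⟩ := Opens.isBasis_iff_nbhd.mp X.isBasis_affineOpens (Opens.mem_top x)
  have hWZ : Nonempty (J.subschemeι ⁻¹ᵁ W) := by
    have hx' : x ∈ Set.range J.subschemeι.base := by rw [Scheme.IdealSheafData.range_subschemeι]; exact hx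
    obtain ⟨z, rfl⟩ := hx'
    exact ⟨⟨z, hxW⟩⟩
  haveI : IsIntegral J.subscheme := isIntegral_subscheme J hJrad ⟨⟨x, hx⟩, hJirr⟩
  have hprime : (J.ideal ⟨W, hW⟩).IsPrime := isPrime_ideal J hW hWZ
  -- generators of `Γ(W, M)`
  haveI := hM.ft hW
  obtain ⟨G, hG⟩ := Module.Finite.fg_top (R := Γ(X, W)) (M := Γ(M, W))
  refine heart_induction_of_exactClass hK₁ hK₂ hJtop hJrad hJirr ih hOZ hW hWZ G.card M hM hJM
    ⟨G, le_rfl, fun m => ?_⟩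
  refine ⟨1, fun h1 => hprime.ne_top ((Ideal.eq_top_iff_one _).mpr h1), ?_⟩
  rw [one_smul, hG]
  trivial

/-! ### The finiteness theorem for proper schemes over a field, modulo `Extⁿ(𝒪_X, ι_*𝒪_Z)` -/

/-- **Görtz–Wedhorn II Cor. 23.18 over a field (the named fact
`GortzWedhorn2023_cohomology_proper_coherent_finite`, all coherent `𝓕`, all proper `X`, all `n`)
follows from the finiteness of `Extⁿ_{𝒪_X}(𝒪_X, ι_*𝒪_Z)` for the integral closed subschemes
`ι : Z = V(𝒥) ↪ X`** (`𝒥 ≠ ⊤` radical with irreducible support) of proper `k`-schemes `X`: the dévissage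
`Morphisms/DevissageExactClass` for the exact class `𝒦_Ext` (`Morphisms/ExtUnitFiniteClass`), whose
integral step is `heart_of_exactClass` with `hOZ` the given input.
[cite: GortzWedhorn2023, Thm. 23.17 and Cor. 23.18 (pp. 424–425)] [cite: GortzWedhorn2020, Lemma 12.63 (p. 436)] -/
theorem GortzWedhorn2023_cohomology_proper_coherent_finite_of_structureSheaf
    (hOZ : ∀ (k : Type) [Field k] (X : Over (Spec (CommRingCat.of k))) [IsProper X.hom]
      (J : X.left.IdealSheafData), J ≠ ⊤ → J.radical = J →
      IsPreirreducible ((J.support : Closeds X.left) : Set X.left) →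
      ExtUnitFinite.{1} X ((Scheme.Modules.pushforward J.subschemeι).obj
        (SheafOfModules.unit J.subscheme.ringCatSheaf))) :
    GortzWedhorn2023_cohomology_proper_coherent_finite :=
  GortzWedhorn2023_cohomology_proper_coherent_finite_of_heart
    fun k _ X _ _ J hJtop hJrad hJirr ih M hM hJM =>
      haveI : CompactSpace X.left := QuasiCompact.compactSpace_of_compactSpace X.hom
      heart_of_exactClass (K := fun M => ExtUnitFinite.{1} X M)
        (fun _ hS _ _ h₂ h₃ => ExtUnitFinite.of_shortExact₁ hS h₂ h₃)
        (fun _ hS _ _ h₁ h₃ => ExtUnitFinite.of_shortExact₂ hS h₁ h₃)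
        J hJtop hJrad hJirr ih (hOZ k X J hJtop hJrad hJirr) M hM hJM

end Literature.AlgebraicGeometry.Morphisms

end
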